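import Literature.RingTheory.CohomologyAnnihilator.TowerRestrict
import HarnessLib

/-!
# Syzygies over `R` of modules over `R/I` (Dao–Takahashi, Corollary 5.5)

Topic: `Literature/RingTheory/CohomologyAnnihilator`. The bookkeeping behind the last step of the
proof of [IyengarTakahashi2014, Theorem 5.1] ("It then follows from [DaoTakahashi2014,
Corollary 5.5] that there exists a `G` in `mod R` such that `Ω^{s+d-1}_R M` is in
`|G|_{m(s+d)(n+1)}`"): syzygies over `R` of an `R/I`-module are built from its syzygies over
`R/I` and syzygies of the ideal `I`. Precisely (`res = restriction of scalars along R → R/I`):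

* `exists_isSyzygy_one_restrictScalars` — if `K̄ = Ω_{R/I} X` (cover `P̄`), then some first
  `R`-syzygy `K` of `X|_R` is an extension `0 → T → K → K̄|_R → 0` with `T = Ω_R(P̄|_R)` in
  `add (I ⊕ R)` (`P̄|_R ∈ add (R/I)|_R` and `Ω_R (R/I) = I`);
* `exists_generator_isSyzygy_restrictScalars` — iterating with the horseshoe lemma: for every
  `j` there is a finitely generated `R`-module `C_j` (depending only on `I`, `j`) such that for
  every finitely generated `R/I`-module `X`, every `j`-th `R/I`-syzygy `K̄` of `X` lying in
  `|G|ₙ` (over `R/I`) yields a `j`-th `R`-syzygy of `X|_R` lying in `|G|_R ⊕ C_j|_{n+j}`.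

## References

* S. B. Iyengar, R. Takahashi, *Annihilation of cohomology and strong generation of module
  categories*, IMRN 2016; arXiv:1404.1476 — proof of Theorem 5.1. [`IyengarTakahashi2014`]
* H. Dao, R. Takahashi, *The radius of a subcategory of modules*, Algebra Number Theory 8 (2014),
  Proposition 5.3, Corollary 5.5. [`DaoTakahashi2014`]
-/

noncomputable section

open CategoryTheory CategoryTheory.Limits

universe u

namespace Literature.RingTheory.CohomologyAnnihilator

variable {R : Type u} [CommRing R] (I : Ideal R)

/-- `I = Ω_R (R/I)`: `0 → I → R → R/I → 0`. [folklore] -/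
theorem isSyzygy_one_ideal_quotient :
    IsSyzygy 1 ((restrictScalarsFunctor R (R ⧸ I)).obj (ModuleCat.of (R ⧸ I) (R ⧸ I)))
      (ModuleCat.of R I) := by
  letI : Module R (R ⧸ I) :=
    ((restrictScalarsFunctor R (R ⧸ I)).obj (ModuleCat.of (R ⧸ I) (R ⧸ I))).isModule
  let π : R →ₗ[R] (R ⧸ I) :=
    { toFun := Ideal.Quotient.mk I
      map_add' := fun _ _ => rfl
      map_smul' := fun _ _ => rfl }
  have hπ : Function.Surjective π := Ideal.Quotient.mk_surjective
  have hex : Function.Exact (Submodule.subtype I) π := by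
    intro x
    change Ideal.Quotient.mk I x = 0 ↔ _
    rw [Ideal.Quotient.eq_zero_iff_mem]
    exact ⟨fun hx => ⟨⟨x, hx⟩, rfl⟩, by rintro ⟨y, rfl⟩; exact y.2⟩
  obtain ⟨w, hS⟩ := exists_shortExact_of_linearMap (Y := ModuleCat.of R I) (M := ModuleCat.of R R)
    (X := (restrictScalarsFunctor R (R ⧸ I)).obj (ModuleCat.of (R ⧸ I) (R ⧸ I)))
    (Submodule.subtype I) π Subtype.val_injective hπ hex
  exact isSyzygy_one_iff.mpr ⟨ModuleCat.of R R, inferInstance,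
    (IsProjective.iff_projective (R := R) R).mp inferInstance, _, _, w, hS⟩

/-- **One step**: for `K̄ = Ω_{R/I} X` there is a first `R`-syzygy `K` of `X|_R` and an exact
`0 → T → K → K̄|_R → 0` with `T ∈ add (I ⊕ R)`. [cite: DaoTakahashi2014, Prop. 5.3] -/
theorem exists_isSyzygy_one_restrictScalars {X KX : ModuleCat.{u} (R ⧸ I)} (hK : IsSyzygy 1 X KX) :
    ∃ K : ModuleCat.{u} R, IsSyzygy 1 ((restrictScalarsFunctor R (R ⧸ I)).obj X) K ∧
      ∃ T : ModuleCat.{u} R, IsRetractOfPower (ModuleCat.of R (I × R)) T ∧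
        ∃ (f : T ⟶ K) (g : K ⟶ (restrictScalarsFunctor R (R ⧸ I)).obj KX) (w : f ≫ g = 0),
          (ShortComplex.mk f g w).ShortExact := by
  set res := restrictScalarsFunctor R (R ⧸ I) with hres
  obtain ⟨P, hP, hproj, ι, π, v, hT⟩ := isSyzygy_one_iff.mp hK
  obtain ⟨hι, hπ, hιπ⟩ := shortExact_unpack hT
  haveI := hP
  haveI : Module.Finite R (res.obj P) :=
    finite_restrictScalars_of_surjective Ideal.Quotient.mk_surjective P
  -- a finite free `R`-cover of `P|_R` and its kernel `T`
  obtain ⟨c, φ, hφ⟩ := Module.Finite.exists_fin' R (res.obj P)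
  let T := LinearMap.ker φ
  obtain ⟨wT, hST⟩ := exists_shortExact_of_linearMap (Y := ModuleCat.of R T)
    (M := ModuleCat.of R (Fin c → R)) (X := res.obj P) T.subtype φ Subtype.val_injective hφ
    (LinearMap.exact_subtype_ker_map φ)
  have hTsyz : IsSyzygy 1 (res.obj P) (ModuleCat.of R T) :=
    isSyzygy_one_iff.mpr ⟨ModuleCat.of R (Fin c → R), inferInstance,
      (IsProjective.iff_projective (R := R) (Fin c → R)).mp inferInstance, _, _, wT, hST⟩
  have hTadd : IsRetractOfPower (ModuleCat.of R (I × R)) (ModuleCat.of R T) :=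
    isRetractOfPower_of_isSyzygy_of_isRetractOfPower (isSyzygy_one_ideal_quotient I)
      ((IsRetractOfPower.of_projective (isRetractOfPower_self _) hP hproj).restrictScalars) hTsyz
  -- `K = Ker(Rᶜ → P → X)`
  let πR : res.obj P →ₗ[R] res.obj X := (res.map π).hom
  have hπR : ∀ p, πR p = π p := fun _ => rfl
  let ρ : (Fin c → R) →ₗ[R] res.obj X := πR ∘ₗ φ
  have hρ : Function.Surjective ρ := hπ.comp hφ
  let K := LinearMap.ker ρ
  obtain ⟨wK, hSK⟩ := exists_shortExact_of_linearMap (Y := ModuleCat.of R K)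
    (M := ModuleCat.of R (Fin c → R)) (X := res.obj X) K.subtype ρ Subtype.val_injective hρ
    (LinearMap.exact_subtype_ker_map ρ)
  have hKsyz : IsSyzygy 1 (res.obj X) (ModuleCat.of R K) :=
    isSyzygy_one_iff.mpr ⟨ModuleCat.of R (Fin c → R), inferInstance,
      (IsProjective.iff_projective (R := R) (Fin c → R)).mp inferInstance, _, _, wK, hSK⟩
  -- `0 → T → K → K_X|_R → 0`
  let ιR : res.obj KX →ₗ[R] res.obj P := (res.map ι).hom
  have hιR : ∀ k, ιR k = ι k := fun _ => rfl
  have hιRinj : Function.Injective ιR := hι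
  have hmem : ∀ k : K, φ k.1 ∈ LinearMap.range ιR := fun k =>
    LinearMap.mem_range.mpr ((hιπ _).1 k.2)
  let α : T →ₗ[R] K := LinearMap.codRestrict K T.subtype fun t => by
    change πR (φ t.1) = 0
    rw [show φ t.1 = 0 from t.2, map_zero]
  let eR := LinearEquiv.ofInjective ιR hιRinj
  let β : K →ₗ[R] res.obj KX := eR.symm.toLinearMap ∘ₗ
    LinearMap.codRestrict (LinearMap.range ιR) (φ ∘ₗ K.subtype) hmem
  have hβ : ∀ k : K, ιR (β k) = φ k.1 := fun k => by
    have h := congrArg Subtype.val (eR.apply_symm_apply ⟨φ k.1, hmem k⟩)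
    rw [LinearEquiv.ofInjective_apply] at h
    exact h
  have hαinj : Function.Injective α := fun t₁ t₂ h =>
    Subtype.ext (congrArg (fun k : K => k.1) h)
  have hβsurj : Function.Surjective β := by
    intro k
    obtain ⟨v, hv⟩ := hφ (ιR k)
    have hvK : v ∈ K := by
      change πR (φ v) = 0
      rw [hv]
      exact hιπ.apply_apply_eq_zero k
    exact ⟨⟨v, hvK⟩, hιRinj (by rw [hβ]; exact hv)⟩
  have hαβ : Function.Exact α β := by
    intro k
    constructor
    · intro hk
      have h0 : φ k.1 = 0 := by rw [← hβ, hk, map_zero]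
      exact ⟨⟨k.1, h0⟩, Subtype.ext rfl⟩
    · rintro ⟨t, rfl⟩
      apply hιRinj
      rw [hβ, map_zero]
      exact t.2
  obtain ⟨w, hS⟩ := exists_shortExact_of_linearMap (Y := ModuleCat.of R T) (M := ModuleCat.of R K)
    (X := res.obj KX) α β hαinj hβsurj hαβ
  exact ⟨ModuleCat.of R K, hKsyz, ModuleCat.of R T, hTadd, _, _, w, hS⟩

/-- `G ⊕ C` is a retract of `G ⊕ (C ⊕ D)`. [folklore] -/
theorem isRetractOfPower_prod_prod_fst (G C D : ModuleCat.{u} R) :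
    IsRetractOfPower (ModuleCat.of R (G × (C × D))) (ModuleCat.of R (G × C)) :=
  (isRetractOfPower_self _).of_retract
    (ModuleCat.ofHom (LinearMap.id.prodMap (LinearMap.inl R C D)))
    (ModuleCat.ofHom (LinearMap.id.prodMap (LinearMap.fst R C D)))
    (by apply ModuleCat.hom_ext; exact LinearMap.ext fun _ => rfl)

/-- **[DaoTakahashi2014, Cor. 5.5] / the bookkeeping of [IyengarTakahashi2014, Thm. 5.1]**: over
a noetherian ring, for every `j` there is a finitely generated `R`-module `C_j` (depending only on
the ideal `I` and on `j`) such that: whenever `K̄` is a `j`-th syzygy over `R/I` of a finitely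
generated `R/I`-module `X` and `K̄ ∈ |G|ₙ` over `R/I`, some `j`-th syzygy of `X|_R` over `R` lies
in `|G|_R ⊕ C_j|_{n+j}`. [cite: DaoTakahashi2014, Cor. 5.5; IyengarTakahashi2014, Thm. 5.1
(proof)] -/
theorem exists_generator_isSyzygy_restrictScalars [IsNoetherianRing R] :
    ∀ j : ℕ, ∃ C : ModuleCat.{u} R, Module.Finite R C ∧
      ∀ {X KX : ModuleCat.{u} (R ⧸ I)}, IsSyzygy j X KX → Module.Finite (R ⧸ I) X →
        ∀ {G : ModuleCat.{u} (R ⧸ I)} {n : ℕ}, InTower G n KX →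
          ∃ K : ModuleCat.{u} R, IsSyzygy j ((restrictScalarsFunctor R (R ⧸ I)).obj X) K ∧
            InTower (ModuleCat.of R ((restrictScalarsFunctor R (R ⧸ I)).obj G × C)) (n + j) K
  | 0 => by
    refine ⟨ModuleCat.of R PUnit.{u + 1}, inferInstance, fun {X KX} hK _ {G n} hKT => ?_⟩
    obtain ⟨i⟩ := hK
    refine ⟨(restrictScalarsFunctor R (R ⧸ I)).obj KX,
      ⟨(restrictScalarsFunctor R (R ⧸ I)).mapIso i⟩, ?_⟩
    exact (InTower.restrictScalars hKT).mono_gen (isRetractOfPower_fst _ _)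
  | j + 1 => by
    set res := restrictScalarsFunctor R (R ⧸ I) with hres
    obtain ⟨C, hC, hCj⟩ := exists_generator_isSyzygy_restrictScalars j
    -- `D`: a generator for `j`-th syzygies of modules in `add (I ⊕ R)`
    obtain ⟨D, hD, hDj⟩ := exists_generator_isSyzygy_inTower (ModuleCat.of R (I × R)) j
    haveI := hC
    haveI := hD
    refine ⟨ModuleCat.of R (C × D), inferInstance, fun {X KX} hK hX {G n} hKT => ?_⟩
    haveI := hX
    obtain ⟨X₁, hX₁, hK'⟩ := isSyzygy_succ_iff_exists_first.mp hK
    haveI : Module.Finite (R ⧸ I) X₁ := by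
      obtain ⟨P, hP, -, f, g, w, hS⟩ := isSyzygy_one_iff.mp hX₁
      haveI := hP
      exact Module.Finite.of_injective f.hom hS.moduleCat_injective_f
    -- inductive hypothesis for `(X₁, K̄)`
    obtain ⟨K₁, hK₁, hK₁T⟩ := hCj hK' inferInstance hKT
    -- one step for `(X, X₁)`
    obtain ⟨L, hL, T, hTadd, f, g, w, hS⟩ := exists_isSyzygy_one_restrictScalars I hX₁
    haveI : Module.Finite R T := hTadd.finite
    obtain ⟨Tj, -, hTj⟩ := exists_isSyzygy T j
    have hTjD : InTower D 1 Tj := hDj le_rfl (InTower.of_isRetractOfPower hTadd) hTj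
    -- horseshoe
    obtain ⟨E, hE, f', g', w', hS'⟩ := exists_isSyzygy_of_shortExact hS hTj hK₁
    refine ⟨E, hL.trans hE, ?_⟩
    -- `E ∈ |G|_R ⊕ (C ⊕ D)|_{1 + (n + j)}`
    have h1 : InTower (ModuleCat.of R (res.obj G × (C × D))) 1 Tj :=
      hTjD.mono_gen ((isRetractOfPower_snd _ _).of_isRetractOfPower_gen (isRetractOfPower_snd _ _))
    have h2 : InTower (ModuleCat.of R (res.obj G × (C × D))) (n + j) K₁ :=
      hK₁T.mono_gen (isRetractOfPower_prod_prod_fst _ _ _)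
    have h3 := InTower.of_shortExact h1 h2 hS'
    exact InTower.mono (by omega) h3

end Literature.RingTheory.CohomologyAnnihilator

end
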